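import Literature.NumberTheory.GaloisRepresentations.CohomologicalDimension
import Literature.AnabelianGeometry.AbsoluteAnabelian.MLFGaloisGroups
import Mathlib.FieldTheory.KrullTopology
import Mathlib.FieldTheory.Galois.Basic
import Mathlib.RingTheory.Valuation.RamificationGroup
import Mathlib.NumberTheory.NumberField.Basic
import HarnessLib

/-!
# Neukirch–Uchida, row R0 (TRANSPORT): a number field inside `ℚ̄` versus the abstract number field

Classical algebraic number theory (abc-iut cell, campaign L, GAP row G-L4d2g4-1, `plan/L4/SUBDAG-NeukirchUchida.md`
row **R0 TRANSPORT**, holder abc-iut-w6-d055; one-closure model `Ω₀ := AlgebraicClosure ℚ`, `Γ := Gal(Ω₀/ℚ)`,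
number fields `K : IntermediateField ℚ Ω₀`, `Γ_K := K.fixingSubgroup`).
The tree's local/anabelian facts (`decompositionGroupNF`, [AbsAnab] Prop 1.2.1, `NeukirchUchida F`) are stated for an
ABSTRACT number field `F` with ITS OWN `AlgebraicClosure F`; this file is the dictionary between the two:

* §1 (Krull plumbing, any tower `k ⊆ K ⊆ L`): Mathlib's bare `IntermediateField.fixingSubgroupEquiv K : Γ_K ≃* Gal(L/K)`
  is a HOMEOMORPHISM for the Krull topologies (`fixingSubgroupContinuousMulEquiv`, `K/k` finite for one direction);
* §2 (transport): for `K : IntermediateField ℚ Ω₀`, `Ω₀` is an algebraic closure of `↥K`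
  (`isAlgClosure_intermediateField`), whence the `K`-isomorphism **`closureEquiv K : AlgebraicClosure ↥K ≃ₐ[↥K] Ω₀`**
  (`e_K`) and, for `K/ℚ` finite, the isomorphism of topological groups
  **`absGaloisFixingSubgroupEquiv K : absoluteGaloisGroup ↥K ≃ₜ* Γ_K`** (`ι_K`), with
  `(ι_K σ) x = e_K (σ • e_K⁻¹ x)`; `↥K` is a number field (`numberField_intermediateField`);
* §3 (primes): nontrivial valuation subrings of `Ω₀` pull back along `e_K` to nontrivial valuation subrings of
  `AlgebraicClosure ↥K`, and the decomposition group transports: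
  `σ ∈ decompositionGroupNF ↥K (A.comap e_K) ↔ ι_K σ ∈ A.decompositionSubgroup ℚ` and
  `ι_K(D_{↥K}(A.comap e_K)) = D_A ⊓ Γ_K`;
* §4 (Γ-currency): the continuous injective hom **`absGaloisToRat K : absoluteGaloisGroup ↥K →ₜ* Γ`**, image exactly
  `Γ_K = fixingSubgroup Γ ↑K`, `(absGaloisToRat K σ) • x = e_K (σ • e_K⁻¹ x)`, and the stabiliser transport with
  `MulAction.stabilizer Γ A` (the currency of row R1, `NeukirchUchidaPrimeCorrespondence.lean`).

Nothing here bears on [IUTchIII] Cor. 3.12; no side is taken; (12.1.9)/(12.2.1) are not used.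

## References
* [NeukirchSchmidtWingberg2008] Neukirch–Schmidt–Wingberg, *Cohomology of Number Fields*, (12.2.1) (one closure of `ℚ`).
* [NeukirchANT1999] J. Neukirch, *Algebraic Number Theory*, Ch. IV §1 (infinite Galois theory, Krull topology).
-/

noncomputable section

open Field IntermediateField
open scoped Pointwise

namespace Literature.AnabelianGeometry.AbsoluteAnabelian

open Literature.NumberTheory.GaloisRepresentations

universe u v

/-! ### §1 Krull plumbing: `Γ_K ≃ₜ* Gal(L/K)` -/

section Krull

variable {k : Type u} {L : Type v} [Field k] [Field L] [Algebra k L] (K : IntermediateField k L)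

/-- `restrictScalars` from `Gal(L/K)` to `Gal(L/k)` (the underlying map of `(fixingSubgroupEquiv K).symm`) is
continuous for the Krull topologies: the preimage of `Gal(L/E)`, `E/k` finite, contains `Gal(L/K(E))` and `K(E)/K`
is finite (generated by a `k`-basis of `E`, whose members are algebraic). [cite: NeukirchANT1999, Ch. IV §1] -/
theorem continuous_coe_fixingSubgroupEquiv_symm :
    Continuous (fun σ : L ≃ₐ[K] L => (((fixingSubgroupEquiv K).symm σ : K.fixingSubgroup) : L ≃ₐ[k] L)) := by
  let φ : (L ≃ₐ[K] L) →* (L ≃ₐ[k] L) :=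
    { toFun := fun σ => ((fixingSubgroupEquiv K).symm σ : K.fixingSubgroup)
      map_one' := rfl
      map_mul' := fun _ _ => rfl }
  change Continuous φ
  apply continuous_of_continuousAt_one φ (continuousAt_def.mpr _)
  intro N hN
  rw [map_one] at hN
  obtain ⟨E, hEfd, hE⟩ := (krullTopology_mem_nhds_one_iff k L N).mp hN
  haveI := hEfd
  let b := Module.finBasis k E
  let S : Set L := Set.range fun i => ((b i : E) : L)
  haveI : Finite S := (Set.finite_range _).to_subtype
  have hS : ∀ x ∈ S, IsIntegral K x := by
    rintro _ ⟨i, rfl⟩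
    have hi : IsIntegral k ((b i : E) : L) := (Algebra.IsIntegral.isIntegral (R := k) (b i)).map E.val
    exact hi.tower_top
  haveI : FiniteDimensional K (adjoin K S) := finiteDimensional_adjoin hS
  refine Filter.mem_of_superset ((krullTopology_mem_nhds_one_iff K L _).mpr
    ⟨adjoin K S, inferInstance, subset_rfl⟩) ?_
  intro σ hσ
  refine hE ?_
  rw [SetLike.mem_coe, IntermediateField.mem_fixingSubgroup_iff] at hσ ⊢
  intro x hx
  have hxS : x ∈ adjoin K S := by
    have hmem : (⟨x, hx⟩ : E) ∈ Submodule.span k (Set.range b) := by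
      rw [b.span_eq]; exact Submodule.mem_top
    suffices h : ∀ (y : E), y ∈ Submodule.span k (Set.range b) → (y : L) ∈ adjoin K S from h ⟨x, hx⟩ hmem
    intro y hy
    refine Submodule.span_induction (p := fun (y : E) _ => (y : L) ∈ adjoin K S) ?_ ?_ ?_ ?_ hy
    · rintro _ ⟨i, rfl⟩
      exact subset_adjoin K S ⟨i, rfl⟩
    · exact zero_mem _
    · intro y z _ _ hy hz
      exact add_mem hy hz
    · intro a y _ hy
      have e1 : ((a • y : E) : L) = (algebraMap k K a) • (y : L) := by
        rw [IntermediateField.coe_smul, algebraMap_smul]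
      rw [e1]
      exact (adjoin K S).toSubalgebra.smul_mem hy (algebraMap k K a)
  exact hσ x hxS

/-- `(fixingSubgroupEquiv K).symm : Gal(L/K) → Γ_K` is continuous (subspace topology on `Γ_K`). [cite: NeukirchANT1999, Ch. IV §1] -/
theorem continuous_fixingSubgroupEquiv_symm :
    Continuous ((fixingSubgroupEquiv K).symm : (L ≃ₐ[K] L) → K.fixingSubgroup) :=
  (continuous_coe_fixingSubgroupEquiv_symm K).subtype_mk _

/-- For `K/k` finite, `fixingSubgroupEquiv K : Γ_K → Gal(L/K)` is continuous: the preimage of `Gal(L/E)`, `E/K`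
finite, is the trace on `Γ_K` of the open subgroup `Gal(L/E)` of `Gal(L/k)` (`E/k` finite).
[cite: NeukirchANT1999, Ch. IV §1] -/
theorem continuous_fixingSubgroupEquiv [FiniteDimensional k K] :
    Continuous (fixingSubgroupEquiv K : K.fixingSubgroup → (L ≃ₐ[K] L)) := by
  let ψ : K.fixingSubgroup →* (L ≃ₐ[K] L) := (fixingSubgroupEquiv K).toMonoidHom
  change Continuous ψ
  apply continuous_of_continuousAt_one ψ (continuousAt_def.mpr _)
  intro N hN
  rw [map_one] at hN
  obtain ⟨E, hEfd, hE⟩ := (krullTopology_mem_nhds_one_iff K L N).mp hN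
  haveI := hEfd
  haveI : FiniteDimensional k (restrictScalars k E) := by
    change FiniteDimensional k E
    exact FiniteDimensional.trans k K E
  have hopen : ((restrictScalars k E).fixingSubgroup : Set (L ≃ₐ[k] L)) ∈ nhds (1 : L ≃ₐ[k] L) :=
    (krullTopology_mem_nhds_one_iff k L _).mpr ⟨restrictScalars k E, inferInstance, subset_rfl⟩
  have hpre : (Subtype.val : K.fixingSubgroup → (L ≃ₐ[k] L)) ⁻¹'
      ((restrictScalars k E).fixingSubgroup : Set _) ∈ nhds (1 : K.fixingSubgroup) :=
    continuous_subtype_val.continuousAt.preimage_mem_nhds (by simpa using hopen)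
  refine Filter.mem_of_superset hpre ?_
  intro g hg
  refine hE ?_
  rw [SetLike.mem_coe, IntermediateField.mem_fixingSubgroup_iff]
  rw [Set.mem_preimage, SetLike.mem_coe, IntermediateField.mem_fixingSubgroup_iff] at hg
  intro x hx
  exact hg x hx

/-- **`Γ_K ≃ₜ* Gal(L/K)` as TOPOLOGICAL groups** (`K/k` finite): Mathlib's `IntermediateField.fixingSubgroupEquiv`
with both continuity proofs. [cite: NeukirchANT1999, Ch. IV §1] -/
def fixingSubgroupContinuousMulEquiv [FiniteDimensional k K] : K.fixingSubgroup ≃ₜ* (L ≃ₐ[K] L) :=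
  { fixingSubgroupEquiv K with
    continuous_toFun := continuous_fixingSubgroupEquiv K
    continuous_invFun := continuous_fixingSubgroupEquiv_symm K }

/-- `fixingSubgroupContinuousMulEquiv` acts on `L` as the underlying `k`-automorphism. [cite: NeukirchANT1999, Ch. IV §1] -/
@[simp] theorem fixingSubgroupContinuousMulEquiv_apply [FiniteDimensional k K] (g : K.fixingSubgroup) (x : L) :
    fixingSubgroupContinuousMulEquiv K g x = (g : L ≃ₐ[k] L) x := rfl

/-- The inverse of `fixingSubgroupContinuousMulEquiv` is `restrictScalars` (same underlying map on `L`).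
[cite: NeukirchANT1999, Ch. IV §1] -/
@[simp] theorem coe_fixingSubgroupContinuousMulEquiv_symm_apply [FiniteDimensional k K] (σ : L ≃ₐ[K] L)
    (x : L) : (((fixingSubgroupContinuousMulEquiv K).symm σ : K.fixingSubgroup) : L ≃ₐ[k] L) x = σ x := rfl

end Krull

/-! ### §2 Transport: `Ω₀` as an algebraic closure of `↥K`, `e_K` and `ι_K` -/

section Transport

namespace NeukirchUchidaProof

variable (K : IntermediateField ℚ (AlgebraicClosure ℚ))

/-- `Ω₀ = ℚ̄` is an algebraic closure of every intermediate field `ℚ ⊆ K ⊆ Ω₀` (algebraically closed, and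
algebraic over `K` because algebraic over `ℚ`). [cite: NeukirchANT1999, Ch. IV §1] -/
theorem isAlgClosure_intermediateField : IsAlgClosure K (AlgebraicClosure ℚ) where
  isAlgClosed := inferInstance
  -- the `ℚ`-algebra structure on `ℚ̄` found by instance search is `DivisionRing.toRatAlgebra`, definitionally
  -- equal to `AlgebraicClosure.instAlgebra ℚ`; pass Mathlib's instance explicitly
  isAlgebraic := @Algebra.IsAlgebraic.tower_top ℚ K (AlgebraicClosure ℚ) _ _ _ _ _ _ _
    (AlgebraicClosure.isAlgebraic ℚ)

/-- **`e_K : AlgebraicClosure ↥K ≃ₐ[↥K] Ω₀`** — the abstract algebraic closure of the number field `↥K` identified,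
over `K`, with `Ω₀ = ℚ̄` (Mathlib `IsAlgClosure.equiv`; a CHOICE, fixed once here).
[cite: NeukirchSchmidtWingberg2008, Thm (12.2.1)] -/
def closureEquiv : AlgebraicClosure K ≃ₐ[K] AlgebraicClosure ℚ :=
  letI := isAlgClosure_intermediateField K
  (IsAlgClosure.equiv K (AlgebraicClosure ℚ) (AlgebraicClosure K)).symm

/-- `↥K` is a number field when `K/ℚ` is finite. [cite: NeukirchANT1999, Ch. I §2] -/
theorem numberField_intermediateField [FiniteDimensional ℚ K] : NumberField K := NumberField.mk

variable [FiniteDimensional ℚ K]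

/-- **`ι_K : absoluteGaloisGroup ↥K ≃ₜ* Γ_K`** — the absolute Galois group of the abstract number field `↥K` as a
topological group IS the fixing subgroup `Γ_K = Gal(Ω₀/K) ≤ Gal(Ω₀/ℚ)`: conjugation by `e_K` (tree
`algEquivContinuousMulEquivAbsoluteGaloisGroup`) followed by §1. [cite: NeukirchSchmidtWingberg2008, Thm (12.2.1)] -/
def absGaloisFixingSubgroupEquiv : absoluteGaloisGroup K ≃ₜ* K.fixingSubgroup :=
  letI := isAlgClosure_intermediateField K
  (algEquivContinuousMulEquivAbsoluteGaloisGroup K (AlgebraicClosure ℚ)).symm.trans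
    (fixingSubgroupContinuousMulEquiv K).symm

/-- The formula: `(ι_K σ) x = e_K (σ • e_K⁻¹ x)` for `x ∈ Ω₀`. [cite: NeukirchSchmidtWingberg2008, Thm (12.2.1)] -/
theorem absGaloisFixingSubgroupEquiv_apply (σ : absoluteGaloisGroup K) (x : AlgebraicClosure ℚ) :
    ((absGaloisFixingSubgroupEquiv K σ : K.fixingSubgroup) : AlgebraicClosure ℚ ≃ₐ[ℚ] AlgebraicClosure ℚ) x =
      closureEquiv K (σ • (closureEquiv K).symm x) := by
  rfl


/-- The inverse formula: `(ι_K⁻¹ g) • y = e_K⁻¹ (g (e_K y))`. [cite: NeukirchSchmidtWingberg2008, Thm (12.2.1)] -/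
theorem absGaloisFixingSubgroupEquiv_symm_smul (g : K.fixingSubgroup) (y : AlgebraicClosure K) :
    (absGaloisFixingSubgroupEquiv K).symm g • y =
      (closureEquiv K).symm ((g : AlgebraicClosure ℚ ≃ₐ[ℚ] AlgebraicClosure ℚ) (closureEquiv K y)) := by
  rfl

/-- `ι_K σ` fixes `K` pointwise (it lies in `Γ_K`). [cite: NeukirchSchmidtWingberg2008, Thm (12.2.1)] -/
theorem absGaloisFixingSubgroupEquiv_apply_of_mem (σ : absoluteGaloisGroup K) {x : AlgebraicClosure ℚ} (hx : x ∈ K) :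
    ((absGaloisFixingSubgroupEquiv K σ : K.fixingSubgroup) : AlgebraicClosure ℚ ≃ₐ[ℚ] AlgebraicClosure ℚ) x = x :=
  (IntermediateField.mem_fixingSubgroup_iff _ _).mp (absGaloisFixingSubgroupEquiv K σ).2 x hx

/-! ### §3 Primes: valuation subrings and decomposition groups along `e_K`, `ι_K` -/

omit [FiniteDimensional ℚ K] in
/-- Pull-back of valuation subrings along the bijection `e_K` reflects and preserves non-triviality:
`A.comap e_K ≠ ⊤ ↔ A ≠ ⊤`. [cite: NeukirchSchmidtWingberg2008, Thm (12.2.1)] -/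
theorem comap_closureEquiv_ne_top_iff (A : ValuationSubring (AlgebraicClosure ℚ)) :
    A.comap (closureEquiv K : AlgebraicClosure K →+* AlgebraicClosure ℚ) ≠ ⊤ ↔ A ≠ ⊤ := by
  rw [not_iff_not]
  constructor
  · intro h
    rw [eq_top_iff]
    intro y _
    obtain ⟨x, rfl⟩ := (closureEquiv K).surjective y
    have hx : x ∈ A.comap (closureEquiv K : AlgebraicClosure K →+* AlgebraicClosure ℚ) := by
      rw [h]; trivial
    exact hx
  · intro h
    rw [eq_top_iff]
    intro x _
    change (closureEquiv K : AlgebraicClosure K →+* AlgebraicClosure ℚ) x ∈ A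
    rw [h]; trivial

omit [FiniteDimensional ℚ K] in
/-- Membership in the pulled-back valuation subring. [cite: NeukirchSchmidtWingberg2008, Thm (12.2.1)] -/
theorem mem_comap_closureEquiv_iff (A : ValuationSubring (AlgebraicClosure ℚ)) (y : AlgebraicClosure K) :
    y ∈ A.comap (closureEquiv K : AlgebraicClosure K →+* AlgebraicClosure ℚ) ↔ closureEquiv K y ∈ A :=
  Iff.rfl

/-- **Decomposition groups transport along `ι_K`**: `σ ∈ G_{↥K}` stabilises the pulled-back valuation subring
`A.comap e_K` of `AlgebraicClosure ↥K` iff `ι_K σ ∈ Gal(Ω₀/ℚ)` stabilises `A` (membership in Mathlib's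
`ValuationSubring.decompositionSubgroup ℚ A`). [cite: NeukirchSchmidtWingberg2008, Thm (12.2.1)] -/
theorem mem_stabilizer_comap_closureEquiv_iff (A : ValuationSubring (AlgebraicClosure ℚ)) (σ : absoluteGaloisGroup K) :
    σ ∈ MulAction.stabilizer (absoluteGaloisGroup K)
        (A.comap (closureEquiv K : AlgebraicClosure K →+* AlgebraicClosure ℚ)) ↔
      ((absGaloisFixingSubgroupEquiv K σ : K.fixingSubgroup) : AlgebraicClosure ℚ ≃ₐ[ℚ] AlgebraicClosure ℚ) ∈
        A.decompositionSubgroup ℚ := by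
  set e := closureEquiv K with he
  set g : AlgebraicClosure ℚ ≃ₐ[ℚ] AlgebraicClosure ℚ :=
    ((absGaloisFixingSubgroupEquiv K σ : K.fixingSubgroup) : AlgebraicClosure ℚ ≃ₐ[ℚ] AlgebraicClosure ℚ) with hg
  have hgx : ∀ x, g x = e (σ • e.symm x) := fun x => absGaloisFixingSubgroupEquiv_apply K σ x
  have hginv : ∀ x, g⁻¹ x = e (σ⁻¹ • e.symm x) := by
    intro x
    have h1 : g (e (σ⁻¹ • e.symm x)) = x := by
      rw [hgx, AlgEquiv.symm_apply_apply, smul_smul, mul_inv_cancel, one_smul, AlgEquiv.apply_symm_apply]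
    calc g⁻¹ x = g⁻¹ (g (e (σ⁻¹ • e.symm x))) := by rw [h1]
      _ = e (σ⁻¹ • e.symm x) := by rw [← AlgEquiv.mul_apply, inv_mul_cancel, AlgEquiv.one_apply]
  rw [MulAction.mem_stabilizer_iff, ValuationSubring.decompositionSubgroup, MulAction.mem_stabilizer_iff]
  constructor
  · intro h
    ext x
    rw [ValuationSubring.mem_pointwise_smul_iff_inv_smul_mem, AlgEquiv.smul_def, hginv]
    have := SetLike.ext_iff.mp h (e.symm x)
    rw [ValuationSubring.mem_pointwise_smul_iff_inv_smul_mem, mem_comap_closureEquiv_iff,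
      mem_comap_closureEquiv_iff, AlgEquiv.apply_symm_apply] at this
    exact this
  · intro h
    ext y
    rw [ValuationSubring.mem_pointwise_smul_iff_inv_smul_mem, mem_comap_closureEquiv_iff,
      mem_comap_closureEquiv_iff]
    have := SetLike.ext_iff.mp h (e y)
    rw [ValuationSubring.mem_pointwise_smul_iff_inv_smul_mem, AlgEquiv.smul_def, hginv, AlgEquiv.symm_apply_apply]
      at this
    exact this

/-- The same with the tree's spellings on both sides: `decompositionGroupNF ↥K (A.comap e_K)` and
`decompositionGroupNF ℚ A` (= the stabilisers). [cite: NeukirchSchmidtWingberg2008, Thm (12.2.1)] -/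
theorem mem_decompositionGroupNF_comap_closureEquiv_iff (A : ValuationSubring (AlgebraicClosure ℚ))
    (σ : absoluteGaloisGroup K) :
    σ ∈ decompositionGroupNF K (A.comap (closureEquiv K : AlgebraicClosure K →+* AlgebraicClosure ℚ)) ↔
      (absoluteGaloisGroup.toAlgEquiv ℚ).symm
        ((absGaloisFixingSubgroupEquiv K σ : K.fixingSubgroup) : AlgebraicClosure ℚ ≃ₐ[ℚ] AlgebraicClosure ℚ) ∈
        decompositionGroupNF ℚ A :=
  mem_stabilizer_comap_closureEquiv_iff K A σ

/-- **`ι_K (D_{↥K}(A.comap e_K)) = D_A ⊓ Γ_K`** inside `Gal(Ω₀/ℚ)`: the image of the decomposition group of the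
pulled-back valuation subring under `Γ_K ↪ Gal(Ω₀/ℚ) ∘ ι_K` is the trace of `A`'s decomposition group on `Γ_K`.
[cite: NeukirchSchmidtWingberg2008, Thm (12.2.1)] -/
theorem map_stabilizer_comap_closureEquiv (A : ValuationSubring (AlgebraicClosure ℚ)) :
    (MulAction.stabilizer (absoluteGaloisGroup K)
        (A.comap (closureEquiv K : AlgebraicClosure K →+* AlgebraicClosure ℚ))).map
      (K.fixingSubgroup.subtype.comp (absGaloisFixingSubgroupEquiv K).toMonoidHom) =
      A.decompositionSubgroup ℚ ⊓ K.fixingSubgroup := by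
  ext g
  constructor
  · rintro ⟨σ, hσ, rfl⟩
    refine ⟨(mem_stabilizer_comap_closureEquiv_iff K A σ).mp hσ, ?_⟩
    exact (absGaloisFixingSubgroupEquiv K σ).2
  · rintro ⟨hA, hK⟩
    refine ⟨(absGaloisFixingSubgroupEquiv K).symm ⟨g, hK⟩, ?_, ?_⟩
    · rw [SetLike.mem_coe, mem_stabilizer_comap_closureEquiv_iff, ContinuousMulEquiv.apply_symm_apply]
      exact hA
    · change (((absGaloisFixingSubgroupEquiv K) ((absGaloisFixingSubgroupEquiv K).symm ⟨g, hK⟩) :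
          K.fixingSubgroup) : AlgebraicClosure ℚ ≃ₐ[ℚ] AlgebraicClosure ℚ) = g
      rw [ContinuousMulEquiv.apply_symm_apply]

/-! ### §4 Everything inside `Γ = absoluteGaloisGroup ℚ`: the embedding `G_{↥K} ↪ Γ` with image `Γ_K` -/

/-- **`G_{↥K} →ₜ* Γ`**: the continuous injective homomorphism `absoluteGaloisGroup ↥K → absoluteGaloisGroup ℚ`
(`ι_K` followed by the inclusion `Γ_K ≤ Gal(Ω₀/ℚ)` and the tree's identity `Gal(Ω₀/ℚ) = absoluteGaloisGroup ℚ`).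
Unlike the tree's `absGaloisRestrict ℚ ↥K` (defined through a CHOSEN embedding `Ω₀ → AlgebraicClosure ↥K`, image
only well defined up to conjugacy), this map is built from `e_K` over `K`, so its image is EXACTLY
`Γ_K = fixingSubgroup Γ ↑K`. [cite: NeukirchSchmidtWingberg2008, Thm (12.2.1)] -/
def absGaloisToRat : absoluteGaloisGroup K →ₜ* absoluteGaloisGroup ℚ where
  toMonoidHom :=
    (absoluteGaloisGroupContinuousMulEquiv ℚ).symm.toMulEquiv.toMonoidHom.comp
      (K.fixingSubgroup.subtype.comp (absGaloisFixingSubgroupEquiv K).toMulEquiv.toMonoidHom)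
  continuous_toFun :=
    (absoluteGaloisGroupContinuousMulEquiv ℚ).symm.continuous.comp
      (continuous_subtype_val.comp (absGaloisFixingSubgroupEquiv K).continuous)

/-- The action formula in `Γ`: `(absGaloisToRat K σ) • x = e_K (σ • e_K⁻¹ x)`. [cite: NeukirchSchmidtWingberg2008, Thm (12.2.1)] -/
theorem absGaloisToRat_smul (σ : absoluteGaloisGroup K) (x : AlgebraicClosure ℚ) :
    absGaloisToRat K σ • x = closureEquiv K (σ • (closureEquiv K).symm x) := by
  rfl

/-- `absGaloisToRat K σ`, read back as a `ℚ`-automorphism of `Ω₀`, is `ι_K σ`. [cite: NeukirchSchmidtWingberg2008, Thm (12.2.1)] -/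
theorem toAlgEquiv_absGaloisToRat (σ : absoluteGaloisGroup K) :
    absoluteGaloisGroup.toAlgEquiv ℚ (absGaloisToRat K σ) =
      ((absGaloisFixingSubgroupEquiv K σ : K.fixingSubgroup) : AlgebraicClosure ℚ ≃ₐ[ℚ] AlgebraicClosure ℚ) := by
  rfl

/-- `absGaloisToRat K` is injective. [cite: NeukirchSchmidtWingberg2008, Thm (12.2.1)] -/
theorem absGaloisToRat_injective : Function.Injective (absGaloisToRat K) := by
  intro σ τ h
  have h' : absoluteGaloisGroup.toAlgEquiv ℚ (absGaloisToRat K σ) =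
      absoluteGaloisGroup.toAlgEquiv ℚ (absGaloisToRat K τ) := by rw [h]
  rw [toAlgEquiv_absGaloisToRat, toAlgEquiv_absGaloisToRat] at h'
  exact (absGaloisFixingSubgroupEquiv K).injective (Subtype.ext h')

/-- Membership in the image: `g = absGaloisToRat K σ` for some `σ` iff `g` fixes `K` pointwise.
[cite: NeukirchSchmidtWingberg2008, Thm (12.2.1)] -/
theorem mem_range_absGaloisToRat_iff (g : absoluteGaloisGroup ℚ) :
    g ∈ Set.range (absGaloisToRat K) ↔ ∀ x ∈ K, g • x = x := by
  constructor
  · rintro ⟨σ, rfl⟩ x hx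
    rw [absGaloisToRat_smul]
    have h1 : (closureEquiv K).symm x = algebraMap K (AlgebraicClosure K) ⟨x, hx⟩ := by
      apply (closureEquiv K).injective
      rw [AlgEquiv.apply_symm_apply, AlgEquiv.commutes]
      rfl
    rw [h1, absoluteGaloisGroup.smul_def, AlgEquiv.commutes, AlgEquiv.commutes]
    rfl
  · intro hg
    have hg' : absoluteGaloisGroup.toAlgEquiv ℚ g ∈ K.fixingSubgroup :=
      (IntermediateField.mem_fixingSubgroup_iff _ _).mpr hg
    refine ⟨(absGaloisFixingSubgroupEquiv K).symm ⟨absoluteGaloisGroup.toAlgEquiv ℚ g, hg'⟩, ?_⟩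
    apply (absoluteGaloisGroup.toAlgEquiv ℚ).injective
    rw [toAlgEquiv_absGaloisToRat, ContinuousMulEquiv.apply_symm_apply]

/-- **The image of `absGaloisToRat K` is `Γ_K`**, the subgroup of `Γ` fixing `K` pointwise (Mathlib's
`fixingSubgroup Γ ↑K`; for `Γ` read as `Gal(Ω₀/ℚ)` this is `K.fixingSubgroup`). [cite: NeukirchSchmidtWingberg2008, Thm (12.2.1)] -/
theorem range_absGaloisToRat :
    (absGaloisToRat K).toMonoidHom.range =
      fixingSubgroup (absoluteGaloisGroup ℚ) ((K : Set (AlgebraicClosure ℚ))) := by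
  ext g
  rw [MonoidHom.mem_range, mem_fixingSubgroup_iff]
  exact mem_range_absGaloisToRat_iff K g

/-- **Decomposition groups in `Γ`-currency**: `σ` stabilises `A.comap e_K` iff `absGaloisToRat K σ` stabilises `A`
(stabilisers for the pointwise actions on valuation subrings = `decompositionGroupNF` on either side).
[cite: NeukirchSchmidtWingberg2008, Thm (12.2.1)] -/
theorem mem_stabilizer_comap_iff_absGaloisToRat_mem (A : ValuationSubring (AlgebraicClosure ℚ))
    (σ : absoluteGaloisGroup K) :
    σ ∈ MulAction.stabilizer (absoluteGaloisGroup K)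
        (A.comap (closureEquiv K : AlgebraicClosure K →+* AlgebraicClosure ℚ)) ↔
      absGaloisToRat K σ ∈ MulAction.stabilizer (absoluteGaloisGroup ℚ) A :=
  mem_stabilizer_comap_closureEquiv_iff K A σ

/-- **`D_{↥K}(A.comap e_K) ↦ D_A ⊓ Γ_K` in `Γ`-currency**: the image under `absGaloisToRat K` of the stabiliser of the
pulled-back valuation subring is the trace on `Γ_K` of the stabiliser of `A`.
[cite: NeukirchSchmidtWingberg2008, Thm (12.2.1)] -/
theorem map_stabilizer_comap_absGaloisToRat (A : ValuationSubring (AlgebraicClosure ℚ)) :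
    (MulAction.stabilizer (absoluteGaloisGroup K)
        (A.comap (closureEquiv K : AlgebraicClosure K →+* AlgebraicClosure ℚ))).map (absGaloisToRat K).toMonoidHom =
      MulAction.stabilizer (absoluteGaloisGroup ℚ) A ⊓
        fixingSubgroup (absoluteGaloisGroup ℚ) ((K : Set (AlgebraicClosure ℚ))) := by
  rw [← range_absGaloisToRat]
  ext g
  constructor
  · rintro ⟨σ, hσ, rfl⟩
    exact ⟨(mem_stabilizer_comap_iff_absGaloisToRat_mem K A σ).mp hσ, ⟨σ, rfl⟩⟩
  · rintro ⟨hA, ⟨σ, rfl⟩⟩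
    exact ⟨σ, (mem_stabilizer_comap_iff_absGaloisToRat_mem K A σ).mpr hA, rfl⟩

end NeukirchUchidaProof

end Transport

end Literature.AnabelianGeometry.AbsoluteAnabelian

end
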